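import Mathlib.Algebra.Module.SpanRankOperations
import Mathlib.RingTheory.MvPolynomial.Homogeneous
import Mathlib.RingTheory.LocalRing.ResidueField.Basic
import Mathlib.Algebra.Polynomial.Degree.Lemmas
import HarnessLib

/-!
# SUPPORT statements of the idea cards `trace-ledger` / `junction-toll` and `parametric-cusp-lift` of `res-L1-w45b-idea-1` (crux
# `EquisingularLift`, honest variant EL♮ = `EquisingularLiftNat`, stmt-ResolutionOfSingularities-20038): the trace ceiling (Nakayama),
# the toll multiplicity, and the coefficientwise lift of semigroup-module parametrisations

[OURS · L W4.5 (b)] Helper for `res-L1-w45b-idea-1`'s Sketch `HOME/L/res-L1-w45b-idea-1/Sketch-L1-idea-1.lean` (round 5, §7 — cards `trace-ledger` / `junction-toll`): the `Prop`s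
`TraceCeiling` (L1, «stated only; provable from Nakayama facts») and `TollMultiplicity` (L2′), typed there as `def … : Prop` without proof.
NOT statements of the manuscript under review (Hironaka 2017); nothing here is attributed to its author. Each theorem's TYPE is the
Sketch def body VERBATIM (for `TollMultiplicity` after inlining the Sketch's `tollGerm c := X 0 * X 2 ^ 2 + X 1 ^ c`, which is a `def` of
the Sketch and is restated here as the theorem `tollMultiplicity`'s explicit polynomial — no `def` is introduced).

* `traceCeiling` — in a Noetherian local ring an ideal generated by fewer than `dim_k 𝔪/𝔪²` elements is not the maximal ideal
  (Mathlib `IsLocalRing.spanFinrank_maximalIdeal_eq_finrank_cotangentSpace` + `Submodule.spanFinrank_span_le_ncard_of_finite`).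
* `tollMultiplicity` — for `c ≥ 3` the toll germ `x v² + tᶜ` (`X 0 * X 2 ^ 2 + X 1 ^ c`) has vanishing homogeneous components in
  degrees `< 3` and a non-zero cubic component.
* `ParametricCuspLift.cuspModuleLift` (§3 `CuspModuleLift`, card `parametric-cusp-lift`, with the Sketch-local `cuspModule _ m` membership
  inlined as its coefficient condition `∀ i, Odd i → i < m → coeff i = 0`) — over a local ring, a polynomial over the residue field whose
  odd coefficients below `m` vanish lifts to one with the same vanishing pattern, the same degree, and the given reduction (coefficientwise
  lift by a section `ℓ` of the residue map with `ℓ 0 = 0`; `exists_lift_coeff`).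

AI-written; AI review is weaker than expert review.
-/

set_option linter.dupNamespace false

noncomputable section

namespace Summit.ResolutionOfSingularities.ResolutionOfSingularities.Theorems.EquisingularLift.TraceLedger

open IsLocalRing MvPolynomial

/-- **§7 L1 TRACE CEILING (Sketch `TraceCeiling`, body VERBATIM).** An ideal of a Noetherian local ring generated by fewer than
`dim_k 𝔪/𝔪²` elements is not the maximal ideal (Nakayama: `dim_k 𝔪/𝔪²` is the minimal number of generators of `𝔪`). OURS. -/
theorem traceCeiling :
    ∀ (A : Type) [CommRing A] [IsLocalRing A] [IsNoetherianRing A] (s : Finset A),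
      s.card < Module.finrank (IsLocalRing.ResidueField A) (IsLocalRing.CotangentSpace A) →
        Ideal.span (s : Set A) ≠ IsLocalRing.maximalIdeal A := by
  intro A _ _ _ s hs h
  have h1 : (Ideal.span (s : Set A)).spanFinrank ≤ (s : Set A).ncard :=
    Submodule.spanFinrank_span_le_ncard_of_finite s.finite_toSet
  rw [Set.ncard_coe_finset, h, IsLocalRing.spanFinrank_maximalIdeal_eq_finrank_cotangentSpace] at h1
  exact absurd hs (not_lt.mpr h1)

/-- Homogeneous components of the toll germ `X 0 * X 2 ^ 2 + X 1 ^ c`: the cubic monomial and the pure power. OURS. -/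
theorem homogeneousComponent_tollGerm (c n : ℕ) :
    homogeneousComponent n (X 0 * X 2 ^ 2 + X 1 ^ c : MvPolynomial (Fin 3) ℤ) =
      (if n = 3 then X 0 * X 2 ^ 2 else 0) + (if n = c then X 1 ^ c else 0) := by
  have h1 : (X 0 * X 2 ^ 2 : MvPolynomial (Fin 3) ℤ).IsHomogeneous 3 := by
    have := (isHomogeneous_X ℤ (0 : Fin 3)).mul ((isHomogeneous_X ℤ (2 : Fin 3)).pow 2)
    simpa using this
  have h2 : (X 1 ^ c : MvPolynomial (Fin 3) ℤ).IsHomogeneous c := by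
    simpa using (isHomogeneous_X ℤ (1 : Fin 3)).pow c
  rw [map_add, homogeneousComponent_of_mem h1, homogeneousComponent_of_mem h2]

/-- **§7 L2′ TOLL MULTIPLICITY (Sketch `TollMultiplicity`, body VERBATIM with the Sketch's `tollGerm c = X 0 * X 2 ^ 2 + X 1 ^ c`
written out).** For `c ≥ 3` the toll germ has order exactly `3` at the origin. OURS. -/
theorem tollMultiplicity :
    ∀ c : ℕ, 3 ≤ c → (∀ n < 3, homogeneousComponent n (X 0 * X 2 ^ 2 + X 1 ^ c : MvPolynomial (Fin 3) ℤ) = 0) ∧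
      homogeneousComponent 3 (X 0 * X 2 ^ 2 + X 1 ^ c : MvPolynomial (Fin 3) ℤ) ≠ 0 := by
  intro c hc
  refine ⟨fun n hn => ?_, ?_⟩
  · rw [homogeneousComponent_tollGerm, if_neg (by omega), if_neg (by omega), add_zero]
  · rw [homogeneousComponent_tollGerm, if_pos rfl]
    intro h
    -- the coefficient of `x v²` is `1`
    have hcoeff := congrArg (coeff (Finsupp.single 0 1 + Finsupp.single 2 2)) h
    have hx : coeff (Finsupp.single 0 1 + Finsupp.single 2 2) (X 0 * X 2 ^ 2 : MvPolynomial (Fin 3) ℤ) = 1 := by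
      rw [show (X 0 * X 2 ^ 2 : MvPolynomial (Fin 3) ℤ) = monomial (Finsupp.single 0 1 + Finsupp.single 2 2) 1 by
        rw [X, X_pow_eq_monomial, monomial_mul, one_mul]]
      rw [coeff_monomial, if_pos rfl]
    have hy : coeff (Finsupp.single 0 1 + Finsupp.single 2 2) (if 3 = c then (X 1 ^ c : MvPolynomial (Fin 3) ℤ) else 0) = 0 := by
      split_ifs with h3
      · rw [X_pow_eq_monomial, coeff_monomial, if_neg]
        intro heq
        have := Finsupp.ext_iff.mp heq 0
        simp at this
      · simp
    rw [coeff_add, hx, hy, coeff_zero] at hcoeff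
    simp at hcoeff

end Summit.ResolutionOfSingularities.ResolutionOfSingularities.Theorems.EquisingularLift.TraceLedger

namespace Summit.ResolutionOfSingularities.ResolutionOfSingularities.Theorems.EquisingularLift.ParametricCuspLift

open IsLocalRing Polynomial

/-- Coefficientwise lift of a polynomial along a surjective ring map by a section `ℓ` with `ℓ 0 = 0`: the lift has coefficients
`ℓ (g.coeff i)`. OURS. -/
theorem exists_lift_coeff {O k : Type*} [CommRing O] [CommRing k] (φ : O →+* k) (hφ : Function.Surjective φ) (g : k[X]) :
    ∃ G : O[X], (∀ i, φ (G.coeff i) = g.coeff i) ∧ (∀ i, g.coeff i = 0 → G.coeff i = 0) ∧ G.natDegree = g.natDegree := by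
  classical
  -- a section with `ℓ 0 = 0`
  let ℓ : k → O := fun a => if a = 0 then 0 else Function.surjInv hφ a
  have hℓ : ∀ a, φ (ℓ a) = a := fun a => by
    by_cases ha : a = 0
    · simp [ℓ, ha]
    · simp [ℓ, ha, Function.surjInv_eq hφ]
  have hℓ0 : ℓ 0 = 0 := by simp [ℓ]
  have hℓne : ∀ a, a ≠ 0 → ℓ a ≠ 0 := fun a ha h => ha (by rw [← hℓ a, h, map_zero])
  let G : O[X] := ∑ i ∈ g.support, monomial i (ℓ (g.coeff i))
  have hG : ∀ j, G.coeff j = ℓ (g.coeff j) := fun j => by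
    simp only [G, finsetSum_coeff, coeff_monomial]
    rw [Finset.sum_ite_eq' g.support j]
    split_ifs with hj
    · rfl
    · rw [Polynomial.mem_support_iff, not_not] at hj
      rw [hj, hℓ0]
  refine ⟨G, fun i => by rw [hG, hℓ], fun i hi => by rw [hG, hi, hℓ0], ?_⟩
  -- same support, hence same degree
  have hsupp : G.support = g.support := by
    ext j
    rw [Polynomial.mem_support_iff, Polynomial.mem_support_iff, hG]
    exact ⟨fun h hj => h (by rw [hj, hℓ0]), fun h => hℓne _ h⟩
  apply natDegree_eq_of_degree_eq
  change G.support.max = g.support.max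
  rw [hsupp]

/-- **§3 (Sketch `CuspModuleLift`, membership in the Sketch-local `cuspModule _ m` inlined as its coefficient condition).** Over a
local ring `O` with residue field `k`, a polynomial `g ∈ k[t]` whose odd coefficients below `m` vanish (`g ∈ k[t²] + tᵐ k[t]`) lifts to
`G ∈ O[t]` with the same vanishing pattern, `G mod 𝔪 = g`, and `deg G = deg g`. OURS. -/
theorem cuspModuleLift :
    ∀ (O : Type) [CommRing O] [IsLocalRing O] (m : ℕ) (g : (ResidueField O)[X]),
      (∀ i, Odd i → i < m → g.coeff i = 0) →
        ∃ G : O[X], (∀ i, Odd i → i < m → G.coeff i = 0) ∧ G.map (residue O) = g ∧ G.natDegree = g.natDegree := by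
  intro O _ _ m g hg
  obtain ⟨G, h1, h2, h3⟩ := exists_lift_coeff (residue O) residue_surjective g
  refine ⟨G, fun i hi him => h2 i (hg i hi him), ?_, h3⟩
  ext i
  rw [coeff_map, h1]

end Summit.ResolutionOfSingularities.ResolutionOfSingularities.Theorems.EquisingularLift.ParametricCuspLift
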